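import Mathlib
import Literature.NumberTheory.GaloisRepresentations.AbsGaloisOuterConj
import Literature.NumberTheory.GaloisRepresentations.SatakeFamilyOfFramedGaloisRep
import Literature.NumberTheory.GaloisRepresentations.HeckeCharacterGaloisAvatarProofs
import Literature.NumberTheory.GaloisRepresentations.HeckeCharacterOfRayClass
import Literature.NumberTheory.GaloisRepresentations.FramedRepTwist
import Literature.NumberTheory.GaloisRepresentations.FrobeniusDensity
import Literature.NumberTheory.LFunctions.RayClassConductorUniqueness
import Literature.NumberTheory.Automorphic.SelfdualGL3AdjointLiftProofs
import Literature.NumberTheory.Automorphic.AutomorphicRepsGLSatakeFlathProofs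
import Literature.NumberTheory.Automorphic.ChebotarevArtinRepHolds
import Summits.Langlands.Langlands.Theorems.TwistUnpackaging.Negative.TwistSeparationOrder

/-!
# Artin avatars of the powers of a ray class character — stub `stub_avatarPowers` of line
kummer-chebotarev-separating-twists (crux TwistUnpackaging, stmt-Langlands-10903)

For a number field `F`, a prime `𝔮`, an odd prime `p` and a ray class character `ψ mod 𝔮`
(`Literature.NumberTheory.LFunctions.IsRayClassCharacter 𝔮 ψ`) of exponent `p` off `𝔮`
(`ψ(v)^p = 1` for `v ≠ 𝔮`), we produce rank-one Artin avatars
`e j : Γ_F →ₜ* GL_1(ℂ)` (`j ∈ ℕ`; `e j` is the avatar of the ray class character `ψ^j`) with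

* exponent `p`: `(e j g)^p = 1` for every `g ∈ Γ_F`;
* `e j cc = 1` for every complex conjugation `cc`;
* `e j` unramified at every `v ≠ 𝔮`, with arithmetic-Frobenius characteristic polynomial
  `X - C (ψ v ^ j)` there.

Proof (class field theory dictionary, all inputs proved in the tree):
`ψ^j` is again a ray class character mod `𝔮`
(`Literature.NumberTheory.LFunctions.IsRayClassCharacter.pow_apply`); it is induced by a finite-order
Hecke character `ω_j` unramified off `𝔮` with `ω_j(ϖ_v) = ψ(v)^j`
(`HeckeCharacter.exists_of_isRayClassCharacter`, Cassels–Fröhlich VII §4 Prop. 4.1), whose Artin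
avatar `e j` (`HeckeCharacter.exists_framedArtinRep_of_isFiniteOrder`, Cassels–Fröhlich VII §5.1) is
unramified exactly where `ω_j` is, with `HasFrobCharpolyAt v (X - C (ω_j(ϖ_v)))`.  The closed set
`{g | (e j g)^p = 1}` contains every arithmetic Frobenius at a place `≠ 𝔮` (rank one:
`FramedGaloisRep.hasFrobCharpolyAt_iff_of_rank_one`, and `(ψ(v)^j)^p = (ψ(v)^p)^j = 1`), a dense set
(`absoluteGaloisGroup.frobenius_dense` from `chebotarev_artinRep_holds`, Serre I-2.2 Cor. 2 (a)), hence
is all of `Γ_F`.  A complex conjugation `cc` is an involution (`IsComplexConjugation.sq_eq_one`), so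
`(e j cc)^2 = 1 = (e j cc)^p` with `p` odd forces `e j cc = 1`.
-/

set_option linter.dupNamespace false -- project-wide option (lakefile weak.linter.dupNamespace); `Summit.Langlands.Langlands` is the mandated namespace

open Literature.NumberTheory.GaloisRepresentations Literature.NumberTheory.Automorphic
open IsDedekindDomain NumberField Filter

namespace Summit.Langlands.Langlands.Theorems.TwistUnpackaging.KummerChebotarev

/-- Distinct height-one primes are incomparable: `v ≠ 𝔮 → ¬ 𝔮 ≤ v` (maximality of `𝔮`). -/
private theorem not_asIdeal_le_of_ne {R : Type*} [CommRing R] [IsDedekindDomain R]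
    {v 𝔮 : HeightOneSpectrum R} (h : v ≠ 𝔮) : ¬ 𝔮.asIdeal ≤ v.asIdeal := fun hle =>
  h (HeightOneSpectrum.ext (𝔮.isMaximal.eq_of_le v.isPrime.ne_top hle).symm)

/-- A `1 × 1` invertible matrix whose entry is a `p`-th root of unity satisfies `M ^ p = 1`
(`det` of a `1 × 1` matrix is its entry, `Matrix.det_fin_one`, and `det` is multiplicative). -/
private theorem gl_one_pow_eq_one {A : Type*} [CommRing A] (M : GL (Fin 1) A) {p : ℕ}
    (h : ((M : Matrix (Fin 1) (Fin 1) A) 0 0) ^ p = 1) : M ^ p = 1 := by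
  refine Units.ext (Matrix.ext fun i k => ?_)
  obtain rfl : i = 0 := Subsingleton.elim _ _
  obtain rfl : k = 0 := Subsingleton.elim _ _
  rw [Units.val_pow_eq_pow_val, Units.val_one, Matrix.one_apply_eq,
    ← Matrix.det_fin_one ((M : Matrix (Fin 1) (Fin 1) A) ^ p), Matrix.det_pow, Matrix.det_fin_one, h]

/-- **Stub A2 — Artin avatars of the powers of a ray class character (class field theory
dictionary).**  For a number field `F`, a prime `𝔮`, an odd prime `p` and a ray class character
`ψ mod 𝔮` of exponent `p` off `𝔮`, there are rank-one Artin avatars `e j : Γ_F → GL_1(ℂ)` (`j ∈ ℕ`;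
`e j` is the avatar of the ray class character `ψ^j`) of exponent `p`, trivial at every complex
conjugation, unramified at every `v ≠ 𝔮` with arithmetic-Frobenius value `ψ v ^ j` there.
Proof: `ψ^j` is again a ray class character mod `𝔮` (`IsRayClassCharacter.pow_apply`);
`HeckeCharacter.exists_of_isRayClassCharacter` (finite-order Hecke character `ω_j`, unramified off `𝔮`
with `ω_j(ϖ_v) = ψ(v)^j`) and `HeckeCharacter.exists_framedArtinRep_of_isFiniteOrder` (avatar `e j`,
unramified iff `ω_j` is, with `HasFrobCharpolyAt v (X - C (ω_j(ϖ_v)))`); the closed set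
`{g | (e j g)^p = 1}` contains the Frobenii at the places `≠ 𝔮`, which are dense
(`absoluteGaloisGroup.frobenius_dense` + `chebotarev_artinRep_holds`), hence is everything; a complex
conjugation `cc` has `cc² = 1` (`IsComplexConjugation.sq_eq_one`), so `(e j cc)² = 1 = (e j cc)^p` with
`p` odd forces `e j cc = 1`.  Sources: Cassels–Fröhlich (Tate), Ch. VII §4 Prop. 4.1 and §5.1;
Serre, *Abelian ℓ-adic representations*, I §2.2 Cor. 2 (a). -/
theorem stub_avatarPowers :
    ∀ (F : Type) [Field F] [NumberField F] (𝔮 : HeightOneSpectrum (𝓞 F))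
      (ψ : HeightOneSpectrum (𝓞 F) → ℂ) (p : ℕ), p.Prime → 2 < p →
      Literature.NumberTheory.LFunctions.IsRayClassCharacter 𝔮.asIdeal ψ →
      (∀ v : HeightOneSpectrum (𝓞 F), v ≠ 𝔮 → ψ v ^ p = 1) →
    ∃ e : ℕ → FramedGaloisRep F ℂ 1,
      (∀ j : ℕ, ∀ g : Field.absoluteGaloisGroup F, (e j g) ^ p = 1) ∧
      (∀ (j : ℕ) (φ : F →+* ℝ) (cc : Field.absoluteGaloisGroup F),
          IsComplexConjugation φ cc → e j cc = 1) ∧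
      (∀ j : ℕ, ∀ v : HeightOneSpectrum (𝓞 F), v ≠ 𝔮 → (e j).IsUnramifiedAt v ∧
          (e j).HasFrobCharpolyAt v (Polynomial.X - Polynomial.C (ψ v ^ j))) := by
  intro F _ _ 𝔮 ψ p hp h2p hψ hψp
  -- Steps 1–3: the Artin avatar of the ray class character `ψ^j`, for every `j`
  have key : ∀ j : ℕ, ∃ e : FramedGaloisRep F ℂ 1, ∀ v : HeightOneSpectrum (𝓞 F), v ≠ 𝔮 →
      e.IsUnramifiedAt v ∧ e.HasFrobCharpolyAt v (Polynomial.X - Polynomial.C (ψ v ^ j)) := by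
    intro j
    obtain ⟨ω, hωfin, hω⟩ :=
      HeckeCharacter.exists_of_isRayClassCharacter 𝔮.ne_bot (hψ.pow_apply j)
    obtain ⟨e, he₁, he₂⟩ := ω.exists_framedArtinRep_of_isFiniteOrder hωfin
    refine ⟨e, fun v hv => ?_⟩
    have hωv : ω.IsUnramifiedAt v := (hω v (not_asIdeal_le_of_ne hv)).1
    have hval : ω.valueAtUniformizer v = ψ v ^ j := (hω v (not_asIdeal_le_of_ne hv)).2
    refine ⟨(he₁ v).mpr hωv, ?_⟩
    have h := he₂ v hωv
    rw [hval] at h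
    exact h
  choose e he using key
  -- Step 4: exponent `p`, by density of the Frobenii off `𝔮` and closedness of `{g | (e j g)^p = 1}`
  have hdense := absoluteGaloisGroup.frobenius_dense chebotarev_artinRep_holds F
    ({𝔮} : Set (HeightOneSpectrum (𝓞 F))) (Set.finite_singleton 𝔮)
  have hpow : ∀ j : ℕ, ∀ g : Field.absoluteGaloisGroup F, (e j g) ^ p = 1 := by
    intro j g
    have hclosed : IsClosed {g : Field.absoluteGaloisGroup F | (e j g) ^ p = 1} :=
      isClosed_eq ((map_continuous (e j)).pow p) continuous_const
    refine hclosed.closure_subset_iff.mpr ?_ (hdense g)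
    rintro σ ⟨v, hv, 𝔓, h𝔓, hσ⟩
    have hv' : v ≠ 𝔮 := fun h => hv (Set.mem_singleton_iff.mpr h)
    have h00 := (FramedGaloisRep.hasFrobCharpolyAt_iff_of_rank_one (e j) v _).mp
      (he j v hv').2 𝔓 h𝔓 σ hσ
    refine gl_one_pow_eq_one (e j σ) ?_
    rw [h00, ← pow_mul, mul_comm, pow_mul, hψp v hv', one_pow]
  refine ⟨e, hpow, fun j φ cc hcc => ?_, he⟩
  -- Step 5: complex conjugations are involutions, and `p` is odd
  have h2 : (e j cc) ^ 2 = 1 := by rw [← map_pow, hcc.sq_eq_one, map_one]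
  obtain ⟨k, hk⟩ := hp.odd_of_ne_two h2p.ne'
  have h := hpow j cc
  rw [hk, pow_succ, pow_mul, h2, one_pow, one_mul] at h
  exact h

end Summit.Langlands.Langlands.Theorems.TwistUnpackaging.KummerChebotarev
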